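import Summits.HodgeConjecture.HodgeCM.Model.HypCensus.OmgInsLetters_1

/-! PORT of `HodgeCM/Model/HypCensus/OmgInsLetters.lean` (HodgeCMPerL run 82) — part 2: continuation of `Summits.HodgeConjecture.HodgeCM.Model.HypCensus.OmgInsLetters_1` (split at a top-level declaration boundary by port_pkg.py; scope re-opened below; declarations unchanged). -/

-- port_pkg: scope re-opened for this part (file-level context, then the namespace/section stack open at the cut)
set_option autoImplicit false
noncomputable section
open NumberField NumberField.InfinitePlace
open scoped TensorProduct Classical ComplexConjugate
open MvPolynomial
open Literature.NumberTheory.Automorphic Literature.NumberTheory.Automorphic.UnitaryGroup Literature.NumberTheory.Weil1964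
open Literature.RepresentationTheory.KonnoKonno2007 Literature.RepresentationTheory.KonnoKonno2007.RealDualPair
open Literature.NumberTheory.GelbartRogawski1991 Literature.NumberTheory.GelbartRogawski1991.UnitaryDualPair
open Literature.Analysis.SegalBargmann
open HodgeCM HodgeCM.Model HodgeCM.Adelic
open HodgeCM.PerL34.Fock HodgeCM.PerL34.Fock.PrintDict
open NumberField.SeesawArchTorus
namespace HodgeCM.Model.HypCensus
section Pin
variable {L : CMField} {ι₁ : L →+* ℂ} (V : HermSpace3 L ι₁) (S : StubTree.SeesawDatum L)
variable
  (hGR : (cmSplittingDatum (L : Type) finProdFinEquiv (frameD V) (frameD_real V) (frameD_ne V) (dW S) (dW_real S) (dW_ne S)).CompatibleSplitting)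
  (η : CMAdelic (L : Type) (frameD V) × CMAdelic (L : Type) (dW S) →* ℂˣ)
  (hη : ∀ γU ∈ CMRat (L : Type) (frameD V), ∀ γ ∈ CMRat (L : Type) (dW S), η (γU, γ) = 1)
  (hηc : Continuous fun p => ((η p : ℂˣ) : ℂ))
  (τ : L →+* ℂ) (T : GL (Fin 3) ℂ)
  (hT : formCongr (starRingEnd ℂ) T (V.Hm.map τ) = Literature.Geometry.ComplexHyperbolic.BallModel.J)
variable (hW : (∀ j, 0 < (ι₁ ((dW S) j)).re) ∨ ∀ j, (ι₁ ((dW S) j)).re < 0)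
variable (jD : InfinitePlace (L : Type) → HodgeCM.PerL34.Fock.EqVar → Fin 6) (m₁ m₂ : InfinitePlace (L : Type) → ℤ)
variable {σ : InfinitePlace (L : Type) → Equiv.Perm (Fin 2)}
/-- (Ported verbatim from the HodgeCMPerL package; no docstring in the source.) -/
theorem eSigmaAt_of_eq (i : ∀ b : InfinitePlace (L : Type), locIdx (datumAtσ V S jD (jIOf V S hW) σ b).kind)
    (b : InfinitePlace (L : Type)) (hb : cmPlacesEquiv (L : Type) b = cmPlace (L : Type) ι₁) (u : SeesawArchTorus (L : Type)) :
    eSigmaAt V S hW jD i b u = 1 := by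
  unfold eSigmaAt; rw [if_pos hb]

/-- (Ported verbatim from the HodgeCMPerL package; no docstring in the source.) -/
theorem eSigmaAt_of_delta (i : ∀ b : InfinitePlace (L : Type), locIdx (datumAtσ V S jD (jIOf V S hW) σ b).kind)
    (b : InfinitePlace (L : Type)) (hb : cmPlacesEquiv (L : Type) b ≠ cmPlace (L : Type) ι₁)
    (hsig : ¬ (Nonempty (PosIdx (cmXW (L : Type) (frameD V) (dW S) (dW_real S) ι₁ (cmPlacesEquiv (L : Type) b))) ∧
      Nonempty (NegIdx (cmXW (L : Type) (frameD V) (dW S) (dW_real S) ι₁ (cmPlacesEquiv (L : Type) b)))))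
    (u : SeesawArchTorus (L : Type)) : eSigmaAt V S hW jD i b u = 1 := by
  unfold eSigmaAt; rw [if_neg hb, dif_neg hsig]

/-- (Ported verbatim from the HodgeCMPerL package; no docstring in the source.) -/
theorem eSigmaAt_of_pos (i : ∀ b : InfinitePlace (L : Type), locIdx (datumAtσ V S jD (jIOf V S hW) σ b).kind)
    (b : InfinitePlace (L : Type)) (hb : cmPlacesEquiv (L : Type) b ≠ cmPlace (L : Type) ι₁)
    (hsig : Nonempty (PosIdx (cmXW (L : Type) (frameD V) (dW S) (dW_real S) ι₁ (cmPlacesEquiv (L : Type) b))) ∧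
      Nonempty (NegIdx (cmXW (L : Type) (frameD V) (dW S) (dW_real S) ι₁ (cmPlacesEquiv (L : Type) b))))
    (hQ : IsEmpty (NegIdx (cmXV (L : Type) (frameD V) (frameD_real V) ι₁ (cmPlacesEquiv (L : Type) b)))) (u : SeesawArchTorus (L : Type)) :
    eSigmaAt V S hW jD i b u =
      (cAt b u (Classical.choice hsig.1).1 * (cAt b u (Classical.choice hsig.2).1)⁻¹) ^ sigmaIdx (datumAtσ V S jD (jIOf V S hW) σ b).kind (i b) := by
  unfold eSigmaAt; rw [if_neg hb, dif_pos hsig, if_pos hQ]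

/-- (Ported verbatim from the HodgeCMPerL package; no docstring in the source.) -/
theorem eSigmaAt_of_neg (i : ∀ b : InfinitePlace (L : Type), locIdx (datumAtσ V S jD (jIOf V S hW) σ b).kind)
    (b : InfinitePlace (L : Type)) (hb : cmPlacesEquiv (L : Type) b ≠ cmPlace (L : Type) ι₁)
    (hsig : Nonempty (PosIdx (cmXW (L : Type) (frameD V) (dW S) (dW_real S) ι₁ (cmPlacesEquiv (L : Type) b))) ∧
      Nonempty (NegIdx (cmXW (L : Type) (frameD V) (dW S) (dW_real S) ι₁ (cmPlacesEquiv (L : Type) b))))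
    (hQ : ¬ IsEmpty (NegIdx (cmXV (L : Type) (frameD V) (frameD_real V) ι₁ (cmPlacesEquiv (L : Type) b)))) (u : SeesawArchTorus (L : Type)) :
    eSigmaAt V S hW jD i b u =
      (cAt b u (Classical.choice hsig.2).1 * (cAt b u (Classical.choice hsig.1).1)⁻¹) ^ sigmaIdx (datumAtσ V S jD (jIOf V S hW) σ b).kind (i b) := by
  unfold eSigmaAt; rw [if_neg hb, dif_pos hsig, if_neg hQ]

/-- (Ported verbatim from the HodgeCMPerL package; no docstring in the source.) -/
theorem dLetterAt_cmPlacesEquiv (i : ∀ b : InfinitePlace (L : Type), locIdx (datumAtσ V S jD (jIOf V S hW) σ b).kind)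
    (b : InfinitePlace (L : Type)) (u : SeesawArchTorus (L : Type)) :
    dLetterAt V S hW jD i (cmPlacesEquiv (L : Type) b) u = dAt V S (cmPlacesEquiv (L : Type) b) u * eSigmaAt V S hW jD i b u := by
  unfold dLetterAt; rw [Equiv.symm_apply_apply]

/-- **the per-place eigen-equation of the torus letter on the embedded `locFam` family, for the chosen data.** -/
theorem linSubst_torusLetter_placePoly_famOf
    (i : ∀ b : InfinitePlace (L : Type), locIdx (datumAtσ V S jD (jIOf V S hW) σ b).kind)
    (w : {v : InfinitePlace ↥(maximalRealSubfield L) // v.IsReal}) (u : SeesawArchTorus (L : Type)) :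
    linSubst (star ((reindexUnitary (pairFrame (PosIdx (cmXV (L : Type) (frameD V) (frameD_real V) ι₁ w))
        (NegIdx (cmXV (L : Type) (frameD V) (frameD_real V) ι₁ w)) (PosIdx (cmXW (L : Type) (frameD V) (dW S) (dW_real S) ι₁ w))
        (NegIdx (cmXW (L : Type) (frameD V) (dW S) (dW_real S) ι₁ w)) finProdFinEquiv (cmEpsV (L : Type) (frameD V) (frameD_real V) ι₁ w)
        (cmEpsW (L : Type) (frameD V) (dW S) (dW_real S) ι₁ w))
        (dualPairι (torusPlaceLetter (L : Type) (frameD V) (frameD_real V) (dW S) (dW_real S) ι₁ w u)) :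
          Matrix.unitaryGroup (Fin 6) ℂ) : Matrix (Fin 6) (Fin 6) ℂ))
        (placePoly (L : Type) (frameD V) (frameD_real V) (dW S) (dW_real S) ι₁ (datumAtσ V S jD (jIOf V S hW) σ) m₁ m₂
          (famOf V S hW jD m₁ m₂ i) w) =
      dLetterAt V S hW jD i w u • placePoly (L : Type) (frameD V) (frameD_real V) (dW S) (dW_real S) ι₁ (datumAtσ V S jD (jIOf V S hW) σ) m₁ m₂
          (famOf V S hW jD m₁ m₂ i) w := by
  by_cases hk : (datumAtσ V S jD (jIOf V S hW) σ ((cmPlacesEquiv (L : Type)).symm w)).kind = .iota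
  · -- the place under `ι₁`: the det-line scalar, `Σ`-part `1`
    obtain rfl := eq_cmPlace_of_datumAt_kind V S jD (jIOf V S hW) w hk
    have hι : datumAtσ V S jD (jIOf V S hW) σ ((cmPlacesEquiv (L : Type)).symm (cmPlace (L : Type) ι₁)) =
        PlaceDatum.iota (jIAt (L : Type) (frameD V) (frameD_real V) (dW S) (dW_real S) ι₁ (frameD_sign_ι₁ V) hW) :=
      datumAt_of_eq V S jD (jIOf V S hW) _ (Equiv.apply_symm_apply _ _)
    have hd : dLetterAt V S hW jD i (cmPlace (L : Type) ι₁) u = dIotaAt (L : Type) (frameD V) (dW S) (dW_real S) ι₁ u := by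
      unfold dLetterAt
      rw [dAt_cmPlace, eSigmaAt_of_eq V S hW jD i _ (Equiv.apply_symm_apply _ _), mul_one]
    simp only [hd]
    refine linSubst_placePoly_of_eq_iota (L : Type) (frameD V) (frameD_real V) (dW S) (dW_real S) ι₁ (datumAtσ V S jD (jIOf V S hW) σ) m₁ m₂
      (cmPlace (L : Type) ι₁) _ hι _ _ ?_ _
    have hc := linSubst_torusLetter_placePoly_vacuum_iotaAt (L : Type) (frameD V) (frameD_real V) (dW S) (dW_real S) ι₁
      (frameD_sign_ι₁ V) hW (datumAtσ V S jD (jIOf V S hW) σ) m₁ m₂ hι u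
    rw [placePoly_vacuum, hι] at hc
    exact hc
  · -- off the place under `ι₁`
    obtain ⟨b, rfl⟩ := (cmPlacesEquiv (L : Type)).surjective w
    have hb : cmPlacesEquiv (L : Type) b ≠ cmPlace (L : Type) ι₁ := fun h =>
      hk (by rw [Equiv.symm_apply_apply]; exact datumAt_kind_of_eq V S jD (jIOf V S hW) b h)
    simp only [dLetterAt_cmPlacesEquiv, dAt_of_ne V S b hb, one_mul]
    by_cases hsig : Nonempty (PosIdx (cmXW (L : Type) (frameD V) (dW S) (dW_real S) ι₁ (cmPlacesEquiv (L : Type) b))) ∧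
        Nonempty (NegIdx (cmXW (L : Type) (frameD V) (dW S) (dW_real S) ι₁ (cmPlacesEquiv (L : Type) b)))
    · by_cases hQ : IsEmpty (NegIdx (cmXV (L : Type) (frameD V) (frameD_real V) ι₁ (cmPlacesEquiv (L : Type) b)))
      · simp only [eSigmaAt_of_pos V S hW jD i b hb hsig hQ]
        by_cases hr : σ b (Classical.choice hsig.1).1 = 0
        · exact linSubst_torusLetter_placePoly_locFam_of_eq_sigmaPos (L : Type) (frameD V) (frameD_real V) (dW S) (dW_real S) ι₁
            (datumAtσ V S jD (jIOf V S hW) σ) m₁ m₂ b _ hQ _ _ _ _ (datumAt_of_sigmaPos V S jD (jIOf V S hW) b hb hsig hQ hr) u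
            (famOf V S hW jD m₁ m₂ i) (i b) rfl
        · exact linSubst_torusLetter_placePoly_locFam_of_eq_sigmaPosSwap (L : Type) (frameD V) (frameD_real V) (dW S) (dW_real S) ι₁
            (datumAtσ V S jD (jIOf V S hW) σ) m₁ m₂ b _ hQ _ _ _ _ (datumAt_of_sigmaPosSwap V S jD (jIOf V S hW) b hb hsig hQ hr) u
            (famOf V S hW jD m₁ m₂ i) (i b) rfl
      · simp only [eSigmaAt_of_neg V S hW jD i b hb hsig hQ]
        by_cases hs : σ b (Classical.choice hsig.2).1 = 0
        · exact linSubst_torusLetter_placePoly_locFam_of_eq_sigmaNeg (L : Type) (frameD V) (frameD_real V) (dW S) (dW_real S) ι₁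
            (datumAtσ V S jD (jIOf V S hW) σ) m₁ m₂ b _ _ _ _ _ _ (datumAt_of_sigmaNeg V S jD (jIOf V S hW) b hb hsig hQ hs) u
            (famOf V S hW jD m₁ m₂ i) (i b) rfl
        · exact linSubst_torusLetter_placePoly_locFam_of_eq_sigmaNegSwap (L : Type) (frameD V) (frameD_real V) (dW S) (dW_real S) ι₁
            (datumAtσ V S jD (jIOf V S hW) σ) m₁ m₂ b _ _ _ _ _ _ (datumAt_of_sigmaNegSwap V S jD (jIOf V S hW) b hb hsig hQ hs) u
            (famOf V S hW jD m₁ m₂ i) (i b) rfl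
    · -- a `D₁₂` place: every place polynomial is fixed
      simp only [eSigmaAt_of_delta V S hW jD i b hb hsig, one_smul]
      exact linSubst_placePoly_of_delta (L : Type) (frameD V) (frameD_real V) (dW S) (dW_real S) ι₁ (datumAtσ V S jD (jIOf V S hW) σ) m₁ m₂ _
        (by rw [Equiv.symm_apply_apply]; exact datumAt_kind_of_delta V S jD (jIOf V S hW) b hb hsig) _ _

/-! ### the orientation match -/

/-- the circle coordinates of `archOf t` at the place over `cmPlacesEquiv b` ARE the printed torus coordinates at `b`. -/
theorem cAt_archOf (t : (printPlaces (InfinitePlace (L : Type))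
      (kindOf (L : Type) (frameD V) (frameD_real V) (dW S) (dW_real S) ι₁ (datumAtσ V S jD (jIOf V S hW) σ))
      (lamOf (L : Type) (frameD V) (frameD_real V) (dW S) (dW_real S) ι₁ (datumAtσ V S jD (jIOf V S hW) σ))
      (lamOf_ne_zero (L : Type) (frameD V) (frameD_real V) (dW S) (dW_real S) ι₁ (datumAtσ V S jD (jIOf V S hW) σ))
      (pinnedVacs (kindOf (L : Type) (frameD V) (frameD_real V) (dW S) (dW_real S) ι₁ (datumAtσ V S jD (jIOf V S hW) σ)) m₁ m₂)).Tg)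
    (b : InfinitePlace (L : Type)) :
    cAt b (archOf V S (datumAtσ V S jD (jIOf V S hW) σ) m₁ m₂ t) 0 =
      (((kindCoord _ _ _ (kindOf (L : Type) (frameD V) (frameD_real V) (dW S) (dW_real S) ι₁ (datumAtσ V S jD (jIOf V S hW) σ) b) (t b)).1 :
        Circle) : ℂ) ∧
    cAt b (archOf V S (datumAtσ V S jD (jIOf V S hW) σ) m₁ m₂ t) 1 =
      (((kindCoord _ _ _ (kindOf (L : Type) (frameD V) (frameD_real V) (dW S) (dW_real S) ι₁ (datumAtσ V S jD (jIOf V S hW) σ) b) (t b)).2 :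
        Circle) : ℂ) := by
  have hb : (cmPlaceOver (L : Type) (cmPlacesEquiv (L : Type) b)).1 = b := by
    rw [← cmPlacesEquiv_symm_apply, Equiv.symm_apply_apply]
  constructor
  · rw [cAt, torusPlaceCircles_apply_zero, hb]
    change (((placeCoords (L : Type) ((placesEquiv (L : Type)).symm (placesCoord (InfinitePlace (L : Type)) _ _ _ _ t)) b).1 : Circle) : ℂ) = _
    rw [placeCoords_placesEquiv_symm, placesCoord_apply]
  · rw [cAt, torusPlaceCircles_apply_one, hb]
    change (((placeCoords (L : Type) ((placesEquiv (L : Type)).symm (placesCoord (InfinitePlace (L : Type)) _ _ _ _ t)) b).2 : Circle) : ℂ) = _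
    rw [placeCoords_placesEquiv_symm, placesCoord_apply]

/-- kind-level values of the polynomial excess. -/
theorem polyExcess_of_kind_sigma : ∀ (k : PlaceKind) (i : locIdx k) (u : Circle × Circle), k = .sigma →
    polyExcess k i u = (((u.1 : Circle) : ℂ) * (((u.2 : Circle) : ℂ))⁻¹) ^ sigmaIdx k i
  | .sigma, _, _, _ => rfl
  | .delta, _, _, h => absurd h PlaceKind.noConfusion
  | .iota, _, _, h => absurd h PlaceKind.noConfusion
  | .sigmaSwap, _, _, h => absurd h PlaceKind.noConfusion

/-- (Ported verbatim from the HodgeCMPerL package; no docstring in the source.) -/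
theorem polyExcess_of_kind_sigmaSwap : ∀ (k : PlaceKind) (i : locIdx k) (u : Circle × Circle), k = .sigmaSwap →
    polyExcess k i u = (((u.2 : Circle) : ℂ) * (((u.1 : Circle) : ℂ))⁻¹) ^ sigmaIdx k i
  | .sigmaSwap, _, _, _ => rfl
  | .delta, _, _, h => absurd h PlaceKind.noConfusion
  | .iota, _, _, h => absurd h PlaceKind.noConfusion
  | .sigma, _, _, h => absurd h PlaceKind.noConfusion

/-- (Ported verbatim from the HodgeCMPerL package; no docstring in the source.) -/
theorem polyExcess_of_kind_delta : ∀ (k : PlaceKind) (i : locIdx k) (u : Circle × Circle), k = .delta → polyExcess k i u = 1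
  | .delta, _, _, _ => one_pow _
  | .sigma, _, _, h => absurd h PlaceKind.noConfusion
  | .iota, _, _, h => absurd h PlaceKind.noConfusion
  | .sigmaSwap, _, _, h => absurd h PlaceKind.noConfusion

/-- (Ported verbatim from the HodgeCMPerL package; no docstring in the source.) -/
theorem polyExcess_of_kind_iota : ∀ (k : PlaceKind) (i : locIdx k) (u : Circle × Circle), k = .iota → polyExcess k i u = 1
  | .iota, _, _, _ => one_pow _
  | .sigma, _, _, h => absurd h PlaceKind.noConfusion
  | .delta, _, _, h => absurd h PlaceKind.noConfusion
  | .sigmaSwap, _, _, h => absurd h PlaceKind.noConfusion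

/-- (Ported verbatim from the HodgeCMPerL package; no docstring in the source.) -/
private theorem fin_two_eq_zero_or_eq_one (j : Fin 2) : j = 0 ∨ j = 1 := by
  rcases j with ⟨j, hj⟩
  rcases j with _ | j
  · exact Or.inl rfl
  · rcases j with _ | j
    · exact Or.inr rfl
    · omega

/-- in a sign plane the negative line is the other index than the positive one — read through any permutation of the two indices. -/
theorem perm_negIdx_val_eq_of_posIdx_val {x : Fin 2 → ℝ} (π : Equiv.Perm (Fin 2)) (r : PosIdx x) (s : NegIdx x) :
    π s.1 = if π r.1 = 0 then 1 else 0 := by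
  have hne : π s.1 ≠ π r.1 := fun h => s.2 ((π.injective h) ▸ r.2)
  rcases fin_two_eq_zero_or_eq_one (π r.1) with hr | hr <;> rcases fin_two_eq_zero_or_eq_one (π s.1) with hs | hs
  · exact absurd (hs.trans hr.symm) hne
  · rw [hs, hr]; rfl
  · rw [hs, hr]; rfl
  · exact absurd (hs.trans hr.symm) hne

/-- the circle coordinates of a `σ`-twisted torus element: `c_j(torusSwap σ u) = c_{σ_b j}(u)` at the place over `cmPlacesEquiv b`. -/
theorem cAt_torusSwap (τ : InfinitePlace (L : Type) → Equiv.Perm (Fin 2)) (b : InfinitePlace (L : Type)) (u : SeesawArchTorus (L : Type))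
    (j : Fin 2) : cAt b (torusSwap (L : Type) τ u) j = cAt b u (τ b j) := by
  have hb : (cmPlaceOver (L : Type) (cmPlacesEquiv (L : Type) b)).1 = b := by
    rw [← cmPlacesEquiv_symm_apply, Equiv.symm_apply_apply]
  have key : ∀ j : Fin 2, cAt b (torusSwap (L : Type) τ u) j =
      ((![(SeesawArchTorus.placesEquiv (L : Type) u b).1, (SeesawArchTorus.placesEquiv (L : Type) u b).2] (τ b j) : Circle) : ℂ) := by
    intro j
    have h := placesEquiv_torusSwap (L : Type) τ u b
    fin_cases j
    · change ((torusPlaceCircles (L : Type) (cmPlacesEquiv (L : Type) b) (torusSwap (L : Type) τ u) 0 : Circle) : ℂ) = _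
      rw [torusPlaceCircles_apply_zero, hb]
      change (((SeesawArchTorus.placesEquiv (L : Type) (torusSwap (L : Type) τ u) b).1 : Circle) : ℂ) = _
      rw [h]; rfl
    · change ((torusPlaceCircles (L : Type) (cmPlacesEquiv (L : Type) b) (torusSwap (L : Type) τ u) 1 : Circle) : ℂ) = _
      rw [torusPlaceCircles_apply_one, hb]
      change (((SeesawArchTorus.placesEquiv (L : Type) (torusSwap (L : Type) τ u) b).2 : Circle) : ℂ) = _
      rw [h]; rfl
  rw [key]
  rcases fin_two_eq_zero_or_eq_one (τ b j) with h | h <;> rw [h]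
  · change _ = ((torusPlaceCircles (L : Type) (cmPlacesEquiv (L : Type) b) u 0 : Circle) : ℂ)
    rw [torusPlaceCircles_apply_zero, hb]; rfl
  · change _ = ((torusPlaceCircles (L : Type) (cmPlacesEquiv (L : Type) b) u 1 : Circle) : ℂ)
    rw [torusPlaceCircles_apply_one, hb]; rfl

/-- **THE ORIENTATION MATCH (T12)**: at every place, the `Σ`-part of the Weil letter eigenvalue at the `σ`-twisted torus element behind
the printed torus point `t` IS the printed polynomial excess weight at `t` — because the census `datumAtσ σ` chose the swapped datum exactly
where the positively paired `W`-line, read through `σ_b`, is line `1`.  (`σ = 1`: the `jT₁₂` rows, `torusSwap 1 = id`; `σ_b = placePerm_b`: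
the `jT₃₄` rows, whose chart element is `h·diag(torusSwap σ u)·h⁻¹`, #52.) -/
theorem eSigmaAt_torusSwap_archOf (i : ∀ b : InfinitePlace (L : Type), locIdx (datumAtσ V S jD (jIOf V S hW) σ b).kind)
    (t : (printPlaces (InfinitePlace (L : Type))
      (kindOf (L : Type) (frameD V) (frameD_real V) (dW S) (dW_real S) ι₁ (datumAtσ V S jD (jIOf V S hW) σ))
      (lamOf (L : Type) (frameD V) (frameD_real V) (dW S) (dW_real S) ι₁ (datumAtσ V S jD (jIOf V S hW) σ))
      (lamOf_ne_zero (L : Type) (frameD V) (frameD_real V) (dW S) (dW_real S) ι₁ (datumAtσ V S jD (jIOf V S hW) σ))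
      (pinnedVacs (kindOf (L : Type) (frameD V) (frameD_real V) (dW S) (dW_real S) ι₁ (datumAtσ V S jD (jIOf V S hW) σ)) m₁ m₂)).Tg)
    (b : InfinitePlace (L : Type)) :
    eSigmaAt V S hW jD i b (torusSwap (L : Type) σ (archOf V S (datumAtσ V S jD (jIOf V S hW) σ) m₁ m₂ t)) =
      polyExcess (kindOf (L : Type) (frameD V) (frameD_real V) (dW S) (dW_real S) ι₁ (datumAtσ V S jD (jIOf V S hW) σ) b) (i b)
        (kindCoord _ _ _ (kindOf (L : Type) (frameD V) (frameD_real V) (dW S) (dW_real S) ι₁ (datumAtσ V S jD (jIOf V S hW) σ) b) (t b)) := by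
  obtain ⟨h0, h1⟩ := cAt_archOf V S hW jD m₁ m₂ t b
  have hsw := cAt_torusSwap (L := L) σ b (archOf V S (datumAtσ V S jD (jIOf V S hW) σ) m₁ m₂ t)
  by_cases hb : cmPlacesEquiv (L : Type) b = cmPlace (L : Type) ι₁
  · rw [eSigmaAt_of_eq V S hW jD i b hb, polyExcess_of_kind_iota _ _ _ (datumAt_kind_of_eq V S jD (jIOf V S hW) b hb)]
  by_cases hsig : Nonempty (PosIdx (cmXW (L : Type) (frameD V) (dW S) (dW_real S) ι₁ (cmPlacesEquiv (L : Type) b))) ∧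
      Nonempty (NegIdx (cmXW (L : Type) (frameD V) (dW S) (dW_real S) ι₁ (cmPlacesEquiv (L : Type) b)))
  · have hs01 := perm_negIdx_val_eq_of_posIdx_val (σ b) (Classical.choice hsig.1) (Classical.choice hsig.2)
    by_cases hQ : IsEmpty (NegIdx (cmXV (L : Type) (frameD V) (frameD_real V) ι₁ (cmPlacesEquiv (L : Type) b)))
    · rw [eSigmaAt_of_pos V S hW jD i b hb hsig hQ, hsw, hsw]
      by_cases hr : σ b (Classical.choice hsig.1).1 = 0
      · rw [if_pos hr] at hs01
        have hk : (datumAtσ V S jD (jIOf V S hW) σ b).kind = .sigma := by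
          rw [datumAt_of_sigmaPos V S jD (jIOf V S hW) b hb hsig hQ hr]; rfl
        rw [polyExcess_of_kind_sigma _ _ _ hk, hr, hs01, h0, h1]
      · rw [if_neg hr] at hs01
        have hr1 : σ b (Classical.choice hsig.1).1 = 1 := (fin_two_eq_zero_or_eq_one _).resolve_left hr
        have hk : (datumAtσ V S jD (jIOf V S hW) σ b).kind = .sigmaSwap := by
          rw [datumAt_of_sigmaPosSwap V S jD (jIOf V S hW) b hb hsig hQ hr]; rfl
        rw [polyExcess_of_kind_sigmaSwap _ _ _ hk, hr1, hs01, h0, h1]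
    · rw [eSigmaAt_of_neg V S hW jD i b hb hsig hQ, hsw, hsw]
      by_cases hs : σ b (Classical.choice hsig.2).1 = 0
      · have hr1 : σ b (Classical.choice hsig.1).1 = 1 := by
          rcases fin_two_eq_zero_or_eq_one (σ b (Classical.choice hsig.1).1) with h | h
          · rw [if_pos h] at hs01; rw [hs01] at hs; exact absurd hs one_ne_zero
          · exact h
        have hk : (datumAtσ V S jD (jIOf V S hW) σ b).kind = .sigma := by
          rw [datumAt_of_sigmaNeg V S jD (jIOf V S hW) b hb hsig hQ hs]; rfl
        rw [polyExcess_of_kind_sigma _ _ _ hk, hs, hr1, h0, h1]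
      · have hr0 : σ b (Classical.choice hsig.1).1 = 0 := by
          rcases fin_two_eq_zero_or_eq_one (σ b (Classical.choice hsig.1).1) with h | h
          · exact h
          · rw [if_neg (by rw [h]; exact one_ne_zero)] at hs01; exact absurd hs01 hs
        have hs1 : σ b (Classical.choice hsig.2).1 = 1 := (fin_two_eq_zero_or_eq_one _).resolve_left hs
        have hk : (datumAtσ V S jD (jIOf V S hW) σ b).kind = .sigmaSwap := by
          rw [datumAt_of_sigmaNegSwap V S jD (jIOf V S hW) b hb hsig hQ hs]; rfl
        rw [polyExcess_of_kind_sigmaSwap _ _ _ hk, hs1, hr0, h0, h1]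
  · rw [eSigmaAt_of_delta V S hW jD i b hb hsig, polyExcess_of_kind_delta _ _ _ (datumAt_kind_of_delta V S jD (jIOf V S hW) b hb hsig)]

/-- `torusSwap 1` is the identity. -/
theorem torusSwap_one (u : SeesawArchTorus (L : Type)) : torusSwap (L : Type) (1 : InfinitePlace (L : Type) → Equiv.Perm (Fin 2)) u = u := by
  apply (SeesawArchTorus.placesEquiv (L : Type)).injective
  funext w
  rw [placesEquiv_torusSwap]
  rfl

/-- **the orientation match for the `jT₁₂` rows** (`σ = 1`, the census of record `datumAt`). -/
theorem eSigmaAt_archOf (i : ∀ b : InfinitePlace (L : Type), locIdx (datumAt V S jD (jIOf V S hW) b).kind)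
    (t : (printPlaces (InfinitePlace (L : Type))
      (kindOf (L : Type) (frameD V) (frameD_real V) (dW S) (dW_real S) ι₁ (datumAt V S jD (jIOf V S hW)))
      (lamOf (L : Type) (frameD V) (frameD_real V) (dW S) (dW_real S) ι₁ (datumAt V S jD (jIOf V S hW)))
      (lamOf_ne_zero (L : Type) (frameD V) (frameD_real V) (dW S) (dW_real S) ι₁ (datumAt V S jD (jIOf V S hW)))
      (pinnedVacs (kindOf (L : Type) (frameD V) (frameD_real V) (dW S) (dW_real S) ι₁ (datumAt V S jD (jIOf V S hW))) m₁ m₂)).Tg)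
    (b : InfinitePlace (L : Type)) :
    eSigmaAt V S hW jD i b (archOf V S (datumAt V S jD (jIOf V S hW)) m₁ m₂ t) =
      polyExcess (kindOf (L : Type) (frameD V) (frameD_real V) (dW S) (dW_real S) ι₁ (datumAt V S jD (jIOf V S hW)) b) (i b)
        (kindCoord _ _ _ (kindOf (L : Type) (frameD V) (frameD_real V) (dW S) (dW_real S) ι₁ (datumAt V S jD (jIOf V S hW)) b) (t b)) := by
  have h := eSigmaAt_torusSwap_archOf V S hW jD m₁ m₂ (σ := 1) i t b
  rwa [torusSwap_one] at h

end Pin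

end HodgeCM.Model.HypCensus

end
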